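import Mathlib.Analysis.SpecialFunctions.Trigonometric.Series
import Mathlib.Analysis.SpecificLimits.Normed

/-!
# The confluent hypergeometric limit function `₀F₁(; b; z)`, the normalised Bessel function
# `ξ(α, x) = ₀F₁(; α+1; −x²/4) = Γ(α+1)(2/x)^α J_α(x)`, the half-integer closed forms, and a certified alternating enclosure

Sources (all statements PROVED here from Mathlib; 0 facts). [DLMF §16.2, Eq. 16.2.1: the generalized hypergeometric series
`pFq(a; b; z) = Σ_k (a_1)_k⋯(a_p)_k/((b_1)_k⋯(b_q)_k) z^k/k!`, here `p = 0`, `q = 1`: `₀F₁(−; b; z) = Σ_{k≥0} z^k/(k!(b)_k)`; §16.2(iii):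
for `p ≤ q` the series converges for all finite `z`; §5.2(iii), Eq. 5.2.5: Pochhammer's symbol `(a)_0 = 1`, `(a)_k = a(a+1)⋯(a+k−1)`;
§10.16, Eq. 10.16.9: `J_ν(z) = (½z)^ν/Γ(ν+1) ₀F₁(−; ν+1; −¼z²)`; Eq. 10.16.1: `J_{1/2}(z) = (2/(πz))^{1/2} sin z`, `J_{−1/2}(z) =
(2/(πz))^{1/2} cos z`.] [Moore1979 = R. E. Moore, *Methods and Applications of Interval Analysis*, SIAM 1979, §3.2 Thm 3.1 (an
inclusion monotonic interval extension encloses the range) — the discipline of the exact-rational checker below.] The function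
`x ↦ Γ(α+1)(2/x)^α J_α(x) = ₀F₁(−; α+1; −x²/4)` (value `1` at `x = 0`; Jahnke–Emde's `Λ_α`) is written `ξ(α, x)` following
Ducas–Pulles (J. Cryptology 2025, §3.1, where it carries the moments of `cos(2π⟨u, v⟩)` for `v` uniform on a sphere or a ball and is
evaluated with mpmath's `hyp0f1`); the cosine transforms themselves are `Literature.Probability.Distributions.SphereUniformCos`.

What is here: the rising factorial `poch`, the term and the sum `hyp0F1 b z := Σ' z^k/(k!(b)_k)` with summability for `b > 0`
(domination by `Σ |z|^k/(k! b^k)`), `xi`; the half-integer closed forms `₀F₁(; ½; −x²/4) = cos x` and `x·₀F₁(; 3/2; −x²/4) = sin x`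
from Mathlib's `Real.hasSum_cos` / `Real.hasSum_sin` (i.e. `ξ(−½, x) = cos x`, `ξ(½, x) = sin x/x`: Eq. 10.16.1 through 10.16.9);
for `z = −y ≤ 0` the ALTERNATING ENCLOSURE: once `y ≤ (m+1)(b+m)` the terms from index `m` on alternate with non-increasing modulus, so
`₀F₁(; b; −y)` lies between the partial sums `S_m` and `S_{m+1}` (Leibniz's bound, via Mathlib's antitone alternating-series lemmas);
an exact rational one-pass evaluator `stepQ`/`partialQ`, the checker `hyp0F1Check b y m lo hi` and its soundness `hyp0F1_mem_of_check`
(`decide +kernel` pattern), with the smoke test `cos 2 = ₀F₁(; ½; −1) ∈ [−0.4161469, −0.4161468]`.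
-/

noncomputable section

open Finset Filter Topology

namespace Literature.Analysis.SpecialFunctions.Hyp0F1

/-! ### Rising factorial and the series term -/

/-- Rising factorial `(b)_k = b(b+1)⋯(b+k−1)`. [cite: DLMF, §16.2 Eq. 16.2.1] -/
def poch (b : ℝ) (k : ℕ) : ℝ := ∏ i ∈ range k, (b + i)

/-- `(b)_0 = 1`. [cite: DLMF, §5.2(iii) Eq. 5.2.5] -/
theorem poch_zero (b : ℝ) : poch b 0 = 1 := by simp [poch]

/-- `(b)_{k+1} = (b)_k·(b+k)`. [cite: DLMF, §5.2(iii) Eq. 5.2.5] -/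
theorem poch_succ (b : ℝ) (k : ℕ) : poch b (k + 1) = poch b k * (b + k) := by
  simp [poch, prod_range_succ]

/-- `(b)_k > 0` for `b > 0`. [cite: DLMF, §5.2(iii)] -/
theorem poch_pos {b : ℝ} (hb : 0 < b) (k : ℕ) : 0 < poch b k :=
  prod_pos fun i _ => by positivity

/-- `b^k ≤ (b)_k` for `b > 0`. [folklore] -/
private theorem pow_le_poch {b : ℝ} (hb : 0 < b) (k : ℕ) : b ^ k ≤ poch b k := by
  induction k with
  | zero => simp [poch]
  | succ k ih =>
      rw [pow_succ, poch_succ]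
      exact mul_le_mul ih (by linarith) hb.le (poch_pos hb k).le

/-- The `k`-th term `z^k/(k!·(b)_k)` of `₀F₁(; b; z)`. [cite: DLMF, §16.2 Eq. 16.2.1] -/
def hyp0F1Term (b z : ℝ) (k : ℕ) : ℝ := z ^ k / ((k.factorial : ℝ) * poch b k)

/-- `₀F₁(; b; z) := Σ_k z^k/(k!·(b)_k)` (as a `tsum`; summable for `b > 0`). [cite: DLMF, §16.2 Eq. 16.2.1] -/
def hyp0F1 (b z : ℝ) : ℝ := ∑' k, hyp0F1Term b z k

/-- `ξ(α, x) := ₀F₁(; α+1; −x²/4)` (`= Γ(α+1)(2/x)^α J_α(x)` by DLMF 10.16.9). [cite: DLMF, §10.16 Eq. 10.16.9] -/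
def xi (α x : ℝ) : ℝ := hyp0F1 (α + 1) (-(x ^ 2 / 4))

/-- Term `0` is `1`. [cite: DLMF, §16.2 Eq. 16.2.1] -/
theorem hyp0F1Term_zero (b z : ℝ) : hyp0F1Term b z 0 = 1 := by simp [hyp0F1Term, poch]

/-- Term ratio: `t_{k+1} = t_k · z/((k+1)(b+k))` (`b > 0`). [cite: DLMF, §16.2 Eq. 16.2.1] -/
theorem hyp0F1Term_succ {b : ℝ} (hb : 0 < b) (z : ℝ) (k : ℕ) :
    hyp0F1Term b z (k + 1) = hyp0F1Term b z k * (z / (((k : ℝ) + 1) * (b + k))) := by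
  unfold hyp0F1Term
  rw [poch_succ, Nat.factorial_succ, pow_succ]
  push_cast
  have h1 : (k.factorial : ℝ) ≠ 0 := by positivity
  have h2 : poch b k ≠ 0 := (poch_pos hb k).ne'
  have h3 : (b + k) ≠ 0 := by positivity
  have h4 : ((k : ℝ) + 1) ≠ 0 := by positivity
  field_simp

/-- Domination by the exponential series: `|t_k| ≤ (|z|/b)^k/k!` (`b > 0`). [folklore] -/
private theorem abs_hyp0F1Term_le {b : ℝ} (hb : 0 < b) (z : ℝ) (k : ℕ) :
    |hyp0F1Term b z k| ≤ (|z| / b) ^ k / k.factorial := by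
  unfold hyp0F1Term
  have hp := poch_pos hb k
  have hf : (0 : ℝ) < k.factorial := by positivity
  rw [abs_div, abs_pow, abs_of_pos (mul_pos hf hp), div_pow, div_div, mul_comm]
  apply div_le_div_of_nonneg_left (by positivity) (by positivity)
  exact mul_le_mul_of_nonneg_right (pow_le_poch hb k) hf.le

/-- `₀F₁(; b; z)` converges absolutely for `b > 0`. [cite: DLMF, §16.2(iii)] -/
theorem summable_hyp0F1Term {b : ℝ} (hb : 0 < b) (z : ℝ) : Summable (hyp0F1Term b z) :=
  Summable.of_norm_bounded (Real.summable_pow_div_factorial (|z| / b)) fun k => by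
    simpa [Real.norm_eq_abs] using abs_hyp0F1Term_le hb z k

/-- The defining `HasSum`. [cite: DLMF, §16.2(iii)] -/
theorem hasSum_hyp0F1 {b : ℝ} (hb : 0 < b) (z : ℝ) : HasSum (hyp0F1Term b z) (hyp0F1 b z) :=
  (summable_hyp0F1Term hb z).hasSum

/-- `₀F₁(; b; 0) = 1`. [cite: DLMF, §16.2 Eq. 16.2.1] -/
theorem hyp0F1_zero_right {b : ℝ} (hb : 0 < b) : hyp0F1 b 0 = 1 := by
  have h : HasSum (hyp0F1Term b 0) (hyp0F1Term b 0 0) :=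
    hasSum_single 0 fun k hk => by
      unfold hyp0F1Term; rw [zero_pow hk, zero_div]
  rw [hyp0F1Term_zero] at h
  exact (hasSum_hyp0F1 hb 0).unique h

/-- `ξ(α, 0) = 1` for `α > −1`. [cite: DLMF, §10.16 Eq. 10.16.9] -/
theorem xi_zero_right {α : ℝ} (hα : -1 < α) : xi α 0 = 1 := by
  unfold xi; simpa using hyp0F1_zero_right (b := α + 1) (by linarith)

/-! ### Sanity identities: the half-integer cases are `cos` and `sin` -/

/-- `(½)_k · k! · 4^k = (2k)!`. [folklore] -/
private theorem poch_half_mul (k : ℕ) : poch (1 / 2) k * k.factorial * 4 ^ k = ((2 * k).factorial : ℝ) := by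
  induction k with
  | zero => simp [poch]
  | succ k ih =>
      rw [poch_succ, Nat.factorial_succ, show 2 * (k + 1) = 2 * k + 1 + 1 by ring, Nat.factorial_succ,
        Nat.factorial_succ (2 * k)]
      push_cast
      rw [← ih]
      ring

/-- `(3/2)_k · k! · 4^k = (2k+1)!`. [folklore] -/
private theorem poch_threeHalves_mul (k : ℕ) : poch (3 / 2) k * k.factorial * 4 ^ k = ((2 * k + 1).factorial : ℝ) := by
  induction k with
  | zero => simp [poch]
  | succ k ih =>
      rw [poch_succ, Nat.factorial_succ, show 2 * (k + 1) + 1 = 2 * k + 2 + 1 by ring, Nat.factorial_succ,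
        show 2 * k + 2 = 2 * k + 1 + 1 by ring, Nat.factorial_succ (2 * k + 1)]
      push_cast
      rw [← ih]
      ring

/-- The `cos` series term: `t_k(½, −x²/4) = (−1)^k x^{2k}/(2k)!`. [folklore] -/
private theorem hyp0F1Term_half (x : ℝ) (k : ℕ) :
    hyp0F1Term (1 / 2) (-(x ^ 2 / 4)) k = (-1) ^ k * x ^ (2 * k) / ((2 * k).factorial : ℝ) := by
  unfold hyp0F1Term
  rw [← poch_half_mul k]
  have hp := poch_pos (b := (1 / 2 : ℝ)) (by norm_num) k
  have hf : (0 : ℝ) < k.factorial := by positivity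
  rw [show (-(x ^ 2 / 4)) ^ k = (-1) ^ k * x ^ (2 * k) / 4 ^ k by rw [neg_eq_neg_one_mul, mul_pow, pow_mul, div_pow]; ring]
  field_simp

/-- The `sin` series term: `x·t_k(3/2, −x²/4) = (−1)^k x^{2k+1}/(2k+1)!`. [folklore] -/
private theorem mul_hyp0F1Term_threeHalves (x : ℝ) (k : ℕ) :
    x * hyp0F1Term (3 / 2) (-(x ^ 2 / 4)) k = (-1) ^ k * x ^ (2 * k + 1) / ((2 * k + 1).factorial : ℝ) := by
  unfold hyp0F1Term
  rw [← poch_threeHalves_mul k]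
  have hp := poch_pos (b := (3 / 2 : ℝ)) (by norm_num) k
  have hf : (0 : ℝ) < k.factorial := by positivity
  rw [show (-(x ^ 2 / 4)) ^ k = (-1) ^ k * x ^ (2 * k) / 4 ^ k by rw [neg_eq_neg_one_mul, mul_pow, pow_mul, div_pow]; ring]
  field_simp
  ring

/-- **`₀F₁(; ½; −x²/4) = cos x`** (so `ξ(−½, x) = cos x`). [DLMF §10.16.9 with `J_{−1/2}`] [cite: DLMF, §10.16 Eqs. 10.16.1, 10.16.9] -/
theorem hyp0F1_half_eq_cos (x : ℝ) : hyp0F1 (1 / 2) (-(x ^ 2 / 4)) = Real.cos x := by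
  have h1 := hasSum_hyp0F1 (b := (1 / 2 : ℝ)) (by norm_num) (-(x ^ 2 / 4))
  have h2 : HasSum (hyp0F1Term (1 / 2) (-(x ^ 2 / 4))) (Real.cos x) := by
    have := Real.hasSum_cos x
    refine this.congr_fun fun k => ?_
    rw [hyp0F1Term_half]
  exact h1.unique h2

/-- `ξ(−½, x) = cos x`. [cite: DLMF, §10.16 Eqs. 10.16.1, 10.16.9] -/
theorem xi_neg_half (x : ℝ) : xi (-1 / 2) x = Real.cos x := by
  unfold xi; rw [show (-1 / 2 : ℝ) + 1 = 1 / 2 by norm_num]; exact hyp0F1_half_eq_cos x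

/-- **`x·₀F₁(; 3/2; −x²/4) = sin x`** (so `ξ(½, x) = sin x/x`). [DLMF §10.16.9 with `J_{1/2}`] [cite: DLMF, §10.16 Eqs. 10.16.1, 10.16.9] -/
theorem mul_hyp0F1_threeHalves_eq_sin (x : ℝ) : x * hyp0F1 (3 / 2) (-(x ^ 2 / 4)) = Real.sin x := by
  have h1 := (hasSum_hyp0F1 (b := (3 / 2 : ℝ)) (by norm_num) (-(x ^ 2 / 4))).mul_left x
  have h2 : HasSum (fun k => x * hyp0F1Term (3 / 2) (-(x ^ 2 / 4)) k) (Real.sin x) := by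
    have := Real.hasSum_sin x
    refine this.congr_fun fun k => ?_
    rw [mul_hyp0F1Term_threeHalves]
  exact h1.unique h2

/-- `ξ(½, x) = sin x / x` for `x ≠ 0`. [cite: DLMF, §10.16 Eqs. 10.16.1, 10.16.9] -/
theorem xi_half {x : ℝ} (hx : x ≠ 0) : xi (1 / 2) x = Real.sin x / x := by
  unfold xi
  rw [show (1 / 2 : ℝ) + 1 = 3 / 2 by norm_num, eq_div_iff hx, mul_comm]
  exact mul_hyp0F1_threeHalves_eq_sin x

/-! ### The alternating enclosure for `z = −y ≤ 0` -/

/-- Absolute value of the term at `z = −y`: `a_k = y^k/(k!(b)_k)`. [folklore] -/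
def absTerm (b y : ℝ) (k : ℕ) : ℝ := y ^ k / ((k.factorial : ℝ) * poch b k)

/-- `t_k(b, −y) = (−1)^k a_k`. [folklore] -/
private theorem hyp0F1Term_neg (b y : ℝ) (k : ℕ) : hyp0F1Term b (-y) k = (-1) ^ k * absTerm b y k := by
  unfold hyp0F1Term absTerm
  rw [neg_eq_neg_one_mul, mul_pow]; ring

/-- `a_k ≥ 0` for `y ≥ 0`, `b > 0`. [folklore] -/
private theorem absTerm_nonneg {b y : ℝ} (hb : 0 < b) (hy : 0 ≤ y) (k : ℕ) : 0 ≤ absTerm b y k := by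
  unfold absTerm; have := poch_pos hb k; positivity

/-- Ratio `a_{k+1} = a_k · y/((k+1)(b+k))`. [folklore] -/
private theorem absTerm_succ {b : ℝ} (hb : 0 < b) (y : ℝ) (k : ℕ) :
    absTerm b y (k + 1) = absTerm b y k * (y / (((k : ℝ) + 1) * (b + k))) := by
  have h := hyp0F1Term_succ hb (-y) k
  rw [hyp0F1Term_neg, hyp0F1Term_neg, pow_succ] at h
  have hne : ((-1 : ℝ) ^ k) ≠ 0 := pow_ne_zero _ (by norm_num)
  have : (-1 : ℝ) ^ k * (-1) * absTerm b y (k + 1) = (-1) ^ k * (-1) * (absTerm b y k * (y / (((k : ℝ) + 1) * (b + k)))) := by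
    rw [h]; ring
  have hne' : ((-1 : ℝ) ^ k * (-1)) ≠ 0 := mul_ne_zero hne (by norm_num)
  exact mul_left_cancel₀ hne' this

/-- Beyond `m` with `y ≤ (m+1)(b+m)` the absolute terms are non-increasing. [folklore] -/
private theorem absTerm_antitone_from {b y : ℝ} (hb : 0 < b) (hy : 0 ≤ y) {m : ℕ} (hm : y ≤ ((m : ℝ) + 1) * (b + m)) :
    Antitone (fun j => absTerm b y (m + j)) := by
  refine antitone_nat_of_succ_le fun j => ?_
  show absTerm b y (m + (j + 1)) ≤ absTerm b y (m + j)
  rw [← add_assoc, absTerm_succ hb]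
  have ha := absTerm_nonneg hb hy (m + j)
  have hden : 0 < (((m + j : ℕ) : ℝ) + 1) * (b + (m + j : ℕ)) := by positivity
  have hr : y / ((((m + j : ℕ) : ℝ) + 1) * (b + (m + j : ℕ))) ≤ 1 := by
    rw [div_le_one hden]
    refine hm.trans ?_
    push_cast
    have hj : (0 : ℝ) ≤ j := by positivity
    nlinarith [hb]
  calc absTerm b y (m + j) * (y / ((((m + j : ℕ) : ℝ) + 1) * (b + (m + j : ℕ))))
      ≤ absTerm b y (m + j) * 1 := mul_le_mul_of_nonneg_left hr ha
    _ = absTerm b y (m + j) := mul_one _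

/-- Partial sums `S_n = Σ_{k<n} t_k(b, −y)`. [folklore] -/
def partialSum (b y : ℝ) (n : ℕ) : ℝ := ∑ k ∈ range n, hyp0F1Term b (-y) k

/-- **Alternating enclosure.** For `b > 0`, `y ≥ 0` and `m` with `y ≤ (m+1)(b+m)`: `₀F₁(; b; −y)` lies between `S_m` and `S_{m+1}`.
(Leibniz's bound for the alternating tail of the series). [cite: DLMF, §16.2 Eq. 16.2.1] -/
theorem hyp0F1_mem_partialSums {b y : ℝ} (hb : 0 < b) (hy : 0 ≤ y) {m : ℕ} (hm : y ≤ ((m : ℝ) + 1) * (b + m)) :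
    min (partialSum b y m) (partialSum b y (m + 1)) ≤ hyp0F1 b (-y) ∧
      hyp0F1 b (-y) ≤ max (partialSum b y m) (partialSum b y (m + 1)) := by
  have hS := summable_hyp0F1Term hb (-y)
  -- split the series at `m`
  have hsplit : hyp0F1 b (-y) = partialSum b y m + ∑' j, hyp0F1Term b (-y) (j + m) := by
    unfold hyp0F1 partialSum
    exact (hS.sum_add_tsum_nat_add m).symm
  -- the tail as `(−1)^m` times an alternating series with antitone terms
  set c : ℕ → ℝ := fun j => absTerm b y (m + j) with hc
  have hcanti : Antitone c := absTerm_antitone_from hb hy hm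
  have htail_terms : ∀ j, hyp0F1Term b (-y) (j + m) = (-1) ^ m * ((-1) ^ j * c j) := by
    intro j
    rw [hyp0F1Term_neg, hc]
    simp only
    rw [add_comm j m, pow_add]; ring
  have hSt : Summable fun j => (-1 : ℝ) ^ j * c j := by
    have h1 : Summable fun j => hyp0F1Term b (-y) (j + m) := (summable_nat_add_iff m).2 hS
    have h2 : Summable fun j => (-1 : ℝ) ^ m * ((-1) ^ j * c j) := h1.congr htail_terms
    have h3 := h2.mul_left ((-1 : ℝ) ^ m)
    refine h3.congr fun j => ?_
    rw [← mul_assoc, ← mul_pow, neg_one_mul, neg_neg, one_pow, one_mul]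
  set l := ∑' j, (-1 : ℝ) ^ j * c j with hl
  have hlt : Tendsto (fun n => ∑ j ∈ range n, (-1 : ℝ) ^ j * c j) atTop (𝓝 l) := hSt.hasSum.tendsto_sum_nat
  have hl0 : 0 ≤ l := by simpa using hcanti.alternating_series_le_tendsto hlt 0
  have hl1 : l ≤ c 0 := by simpa using hcanti.tendsto_le_alternating_series hlt 0
  have htail : ∑' j, hyp0F1Term b (-y) (j + m) = (-1) ^ m * l := by
    rw [hl, ← tsum_mul_left]; exact tsum_congr htail_terms
  have hc0 : c 0 = absTerm b y m := by simp [hc]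
  have hSm1 : partialSum b y (m + 1) = partialSum b y m + (-1) ^ m * absTerm b y m := by
    unfold partialSum; rw [sum_range_succ, hyp0F1Term_neg]
  rw [hsplit, htail]
  rw [hc0] at hl1
  -- case on the parity sign `(−1)^m = ±1`
  rcases neg_one_pow_eq_or ℝ m with hpos | hneg
  · rw [hpos, one_mul] at hSm1 ⊢
    constructor
    · exact (min_le_left _ _).trans (by linarith)
    · exact le_trans (by linarith) (le_max_right _ _)
  · rw [hneg, neg_one_mul] at hSm1 ⊢
    constructor
    · exact (min_le_right _ _).trans (by linarith)
    · exact le_trans (by linarith) (le_max_left _ _)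

/-! ### Exact rational evaluation and the kernel checker -/

/-- One-pass exact evaluation over `ℚ`: `stepQ b y n = (t_n, S_n)` with `t_0 = 1`, `S_0 = 0`,
`t_{k+1} = t_k · (−y)/((k+1)(b+k))`, `S_{k+1} = S_k + t_k` (linear in `n`; no term is recomputed). [folklore] -/
def stepQ (b y : ℚ) : ℕ → ℚ × ℚ
  | 0 => (1, 0)
  | k + 1 =>
      let p := stepQ b y k
      (p.1 * (-y / (((k : ℚ) + 1) * (b + k))), p.2 + p.1)

/-- Exact partial sum `S_n = Σ_{k<n} t_k`. [folklore] -/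
def partialQ (b y : ℚ) (n : ℕ) : ℚ := (stepQ b y n).2

/-- `stepQ` computes the real term and the real partial sum (`b > 0`). [folklore] -/
private theorem stepQ_cast {b : ℚ} (hb : 0 < b) (y : ℚ) (n : ℕ) :
    (((stepQ b y n).1 : ℚ) : ℝ) = hyp0F1Term (b : ℝ) (-(y : ℝ)) n ∧
      (((stepQ b y n).2 : ℚ) : ℝ) = partialSum (b : ℝ) (y : ℝ) n := by
  induction n with
  | zero => simp [stepQ, hyp0F1Term_zero, partialSum]
  | succ k ih =>
      obtain ⟨ih1, ih2⟩ := ih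
      constructor
      · simp only [stepQ]
        rw [hyp0F1Term_succ (by exact_mod_cast hb), ← ih1]
        push_cast
        ring
      · simp only [stepQ]
        unfold partialSum at ih2 ⊢
        rw [sum_range_succ, ← ih2, ← ih1]
        push_cast
        ring

/-- `partialQ` is the real partial sum. [folklore] -/
private theorem partialQ_cast {b : ℚ} (hb : 0 < b) (y : ℚ) (n : ℕ) : ((partialQ b y n : ℚ) : ℝ) = partialSum (b : ℝ) (y : ℝ) n :=
  (stepQ_cast hb y n).2

/-- Checker: `b > 0`, `y ≥ 0`, the monotonicity index condition at `m`, and `[lo, hi] ⊇ {S_m, S_{m+1}}`. [folklore] -/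
def hyp0F1Check (b y : ℚ) (m : ℕ) (lo hi : ℚ) : Bool :=
  decide (0 < b) && decide (0 ≤ y) && decide (y ≤ ((m : ℚ) + 1) * (b + m)) &&
    decide (lo ≤ min (partialQ b y m) (partialQ b y (m + 1)) ∧ max (partialQ b y m) (partialQ b y (m + 1)) ≤ hi)

/-- **Soundness**: a passing check encloses `₀F₁(; b; −y)`. [cite: Moore1979, §3.2 Thm 3.1] -/
theorem hyp0F1_mem_of_check {b y : ℚ} {m : ℕ} {lo hi : ℚ} (h : hyp0F1Check b y m lo hi = true) :
    ((lo : ℚ) : ℝ) ≤ hyp0F1 (b : ℝ) (-(y : ℝ)) ∧ hyp0F1 (b : ℝ) (-(y : ℝ)) ≤ ((hi : ℚ) : ℝ) := by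
  unfold hyp0F1Check at h
  simp only [Bool.and_eq_true, decide_eq_true_eq] at h
  obtain ⟨⟨⟨hb, hy⟩, hm⟩, hlo, hhi⟩ := h
  have hbr : (0 : ℝ) < (b : ℝ) := by exact_mod_cast hb
  have hyr : (0 : ℝ) ≤ (y : ℝ) := by exact_mod_cast hy
  have hmr : (y : ℝ) ≤ ((m : ℝ) + 1) * ((b : ℝ) + m) := by exact_mod_cast hm
  obtain ⟨h1, h2⟩ := hyp0F1_mem_partialSums hbr hyr hmr
  rw [← partialQ_cast hb, ← partialQ_cast hb] at h1 h2
  have hlo' : ((lo : ℚ) : ℝ) ≤ min ((partialQ b y m : ℚ) : ℝ) ((partialQ b y (m + 1) : ℚ) : ℝ) := by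
    rw [← Rat.cast_min]; exact_mod_cast hlo
  have hhi' : max ((partialQ b y m : ℚ) : ℝ) ((partialQ b y (m + 1) : ℚ) : ℝ) ≤ ((hi : ℚ) : ℝ) := by
    rw [← Rat.cast_max]; exact_mod_cast hhi
  exact ⟨hlo'.trans h1, h2.trans hhi'⟩

/-! ### Kernel smoke tests -/

/-- `₀F₁(; ½; −1)` (= `cos 2`) from 12 terms. [folklore] -/
private theorem hyp0F1_half_neg_one_check :
    hyp0F1Check (1 / 2) 1 12 (-4161469 / 10000000) (-4161468 / 10000000) = true := by decide +kernel

/-- **`cos 2 ∈ [−0.4161469, −0.4161468]`**, certified through `₀F₁(; ½; −x²/4) = cos x` at `x = 2`. (numerical smoke test of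
the checker). [cite: DLMF, §10.16 Eqs. 10.16.1, 10.16.9] -/
theorem cos_two_mem : (-0.4161469 : ℝ) ≤ Real.cos 2 ∧ Real.cos 2 ≤ -0.4161468 := by
  have h := hyp0F1_mem_of_check hyp0F1_half_neg_one_check
  have e : hyp0F1 (((1 / 2 : ℚ)) : ℝ) (-((1 : ℚ) : ℝ)) = Real.cos 2 := by
    rw [← hyp0F1_half_eq_cos 2]; norm_num
  rw [e] at h
  constructor
  · have := h.1; norm_num at this ⊢; linarith
  · have := h.2; norm_num at this ⊢; linarith

end Literature.Analysis.SpecialFunctions.Hyp0F1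

end
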